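import Summits.QuantumAdvantage.QuantumAdvantage.Theorems.WbwObfuscatedGluedTreesKowGenVocabulary
import Summits.QuantumAdvantage.QuantumAdvantage.Theorems.WbwObfuscatedGluedTreesKowGenTransport
import Summits.QuantumAdvantage.QuantumAdvantage.Theorems.WbwObfuscatedGluedTreesKowGenFactorisation
import Summits.QuantumAdvantage.QuantumAdvantage.Theorems.WbwObfuscatedGluedTreesKowGenAdmissible
import Summits.QuantumAdvantage.QuantumAdvantage.Theorems.WbwObfuscatedGluedTreesKowGenCoherent
import Summits.QuantumAdvantage.QuantumAdvantage.Theorems.WhiteBoxWalkWbwWitnessGlueGenerator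

/-!
# Line `knowledge-of-walk-split`, STAGE 2 — CLOSED skeleton: the landed generator `obfuscatedGluedTreesGen` through
# `KnowledgeTransfer` (crux `WbwObfuscatedGluedTrees`, stmt-QuantumAdvantage-2340, route WhiteBoxWalk)

Lead prover-line-stmt-QuantumAdvantage-2340-1 (2026-08-16), continuing the line of lead -0.

## Where the line stands

Stage 1 is CLOSED: `KnowledgeOfWalkSplit.knowledgeTransfer_holds` (`Theorems/WhiteBoxWalkWbwObfuscatedGluedTrees.lean`,
p92709) proves, for every key-indexed line datum `𝓛 : LineData` admissible for a sub-exponentially secure iO `O`,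
`Coherent 𝓛.M 𝓛.gen₀ 𝓛.answer → KnowledgeOfWalk 𝓛.M 𝓛.gen₀ → WordHard 𝓛.M 𝓛.gen₀ 𝓛.answer → ClauseC (𝓛.gen O) 𝓛.answer`.
The crux item is still INFORMAL (no signature, no route decl), but its generator has LANDED:
`Literature.Computability.Cryptography.obfuscatedGluedTreesGen Λ O P f c = (gen Λ O P, ans Λ O P)` with a parameter
record `Λ : Params` (depth, PRF parameter, key-part length, obfuscator parameter, coin schedule, circuit presentation).
This stage executes the line card's RE-POINTING PLAN on that object.

## Target of stage 2 (checked by `ledger skeleton check … --crux-decl <this namespace>.GeneratorTransfer`)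

`GeneratorTransfer`: for every master datum `D` (schedules as functions of the key-part length `ℓ = t n`, so that the
line's key-indexed families read their level off the key as `|k| / 4`), every reference presentation `Γ₁`, every
`ε > 0`, every sub-exp iO `O` and every PRF scheme `P`:
`GenAdmissible D O P → RefAdmissible D Γ₁ O → KnowledgeOfWalk evalModel (D.lineData Γ₁ P).gen₀ →
 WordHard evalModel (D.lineData Γ₁ P).gen₀ (D.lineData Γ₁ P).answer → ClauseC (gen D.params O P) (ans D.params O P)`,
i.e. clause (C) of `WbwThesis` for `obfuscatedGluedTreesGen D.params` BY NAME, from KWA₀ ∧ WordHard₀ of ONE reference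
presentation IN THE CLEAR, in the honest EVALUATING walk model (Disproof §7 (M)).  Composition
`WbwObfuscatedGluedTrees_of`: `knowledgeTransfer_holds (D.lineData Γ₁ P)` fed by `stub_admissible` and `stub_coherent`,
then moved onto the landed pair by `stub_factorisation` (the generator agrees with `(D.lineData Γ₁ P).gen O`
eventually in the seed length, and its padded answer event is contained in the EXIT-name event) and
`stub_transport` (clause (C) is invariant under eventual agreement / shrinking of the success event).

## The four stubs (all definitional / generic, believed TRUE, provable now)

* `stub_transport` (S; LANDED p97336 `KowGenTransport`) — generic: eventual agreement of generators + containment of success events transports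
  `ClauseC` (monotonicity of `RandAlg.pr` in the event, of `uniformAvg` in the integrand, and
  `SuperpolynomialDecay.trans_eventually_abs_le`).
* `stub_factorisation` (S/M; LANDED p97148 `KowGenFactorisation`) — unfolding: with `4 t n ≤ n` the key `s.take (4 t n)` IS the generator's key material and
  has level `t n`; with the coin-schedule clause of `GenAdmissible` (eventual) the coin segments agree; the answer
  event by `setOf_ans_prefix_subset`.
* `stub_admissible` (M; LANDED p97483 `KowGenAdmissible`) — bookkeeping: the seven clauses of `LineData.Admissible` from `GenAdmissible ∧ RefAdmissible`
  (lengths: `|boolPair| = 2|code| + 2 + N`, `2N ≤ ς ℓ ≤ p(n)` from `ppolyCircuits` membership; ℕ-polynomial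
  evaluation is monotone).
* `stub_coherent` (M, HARDEST — lead; LANDED p97120 `KowGenCoherent`) — the evaluating model on the clear reference instance
  `⟨code (Γ₁ ℓ k), name(ENTRANCE)⟩`: the code decodes (`decodeSC_encodeSizedCircuit`), `Γ₁ ≡ Γ` computes `nbrBit`
  (`GenAdmissible` (7)), the answer string on `name(EXIT)` is `answerBits σ ν (ν EXIT)` (needs
  `nameVal (nameOfVal N t) = t` for `t < ansLen N ≤ 2^N`), which decodes (`decodeAnswer_answerBits`) to the sorted
  names of the EXIT's two children — nonempty (`degree_eq`: degree 2 at depth 0) — so `name(EXIT)` is valid, has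
  length `N = |name(ENTRANCE)|`, and differs from `name(ENTRANCE)` (`exitName_ne_entranceName`).

## What remains of the crux after stage 2 (stated closed in §3, NOT a stub)

`ReferenceHardness D O P` (vocabulary §3): SOME admissible reference presentation satisfies KWA₀ ∧ WordHard₀ — the
existential typing of the reference obfuscation (Disproof T-d/T-d′).  §3 proves the corollaries the planner can type
the crux / glue with: `clauseC_of_referenceHardness`, `typedCrux_of_generatorTransfer`, `wbwEngine_of_generatorTransfer`
(through the landed `wbwEngine_of_obfuscatedGluedTreesGen`).

## Disproof.lean (cycles 1–4) honoured

No `_false_without_` theorem exists (§0 `not_cruxShape_imp`).  §7 (M) "the walk model is free data": answered — the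
datum's model is `evalModel` by construction.  §7 (T8) computable coin budget: the generator carries the schedule
`c n`; `GenAdmissible` (8) ties it to `O.coins` (the datum is `O`-dependent, as §6 (T-b) requires).  §7 (T-d′): the
reference presentation is a separate `Γ₁`, never the quantified `O` applied to `Γ`; KWA₀/WordHard₀ are hypotheses on
it, existential in `ReferenceHardness`.  §0b/TypedTraps: `ans` is EXIT's name padded, never `[]` (`ans_ne_nil`).
§1–§1d, §2 (role order, depth leak, altimeter, structured cycle, malleable names): they bear on the TRUTH of
WordHard₀/KWA₀ for the intended reference presentation (names are SIV encryptions, cycle is Feistel-pseudorandom,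
listing in sorted order — the landed generator's design), not on any stub here.

## Vocabulary

The stage-2 vocabulary is the landed definitions file `Theorems/WbwObfuscatedGluedTreesKowGenVocabulary.lean` (p96436;
namespace `…Theorems.WbwObfuscatedGluedTrees.KnowledgeOfWalk.Generator`), imported; the four stubs are the landed files
`Theorems/WbwObfuscatedGluedTreesKowGen{Transport,Factorisation,Admissible,Coherent}.lean`, imported and re-exported
below under the registered names (statements verbatim).
-/

set_option linter.dupNamespace false


namespace Summit.QuantumAdvantage.QuantumAdvantage.Cruxes.WbwObfuscatedGluedTrees.KnowledgeOfWalkSplit.Generator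

open Literature.Computability.Cryptography Literature.Computability.Complexity Filter Asymptotics
open Literature.Computability.Cryptography.ObfuscatedGluedTrees
open Literature.Computability.QuantumComplexity
open Summit.QuantumAdvantage.QuantumAdvantage.Theorems.WbwObfuscatedGluedTrees.Negative (ClauseC GenType CruxShape)
open Summit.QuantumAdvantage.QuantumAdvantage.Theorems.WbwObfuscatedGluedTrees.KnowledgeOfWalk
  (WalkModel inst KnowledgeOfWalk WordHard Coherent genObf genClear keyed)
open Summit.QuantumAdvantage.QuantumAdvantage.Theorems.WbwObfuscatedGluedTrees.KnowledgeOfWalk.Generator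
open Summit.QuantumAdvantage.QuantumAdvantage.Cruxes.WbwObfuscatedGluedTrees.KnowledgeOfWalkSplit
  (LineData KnowledgeTransfer knowledgeTransfer_holds)

/-! ## §1 The four stubs -/

/-- Statement of `stub_transport`. -/
def TransportLemma : Prop :=
  ∀ (gen gen' ans ans' : List Bool → List Bool),
    (∃ n₀ : ℕ, ∀ s : List Bool, n₀ ≤ s.length → gen s = gen' s ∧ {y | ans s <+: y} ⊆ {y | ans' s <+: y}) →
    ClauseC gen' ans' → ClauseC gen ans

/-- Statement of `stub_factorisation`. -/
def FactorisationLemma : Prop :=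
  ∀ (D : MasterData) (Γ₁ : D.Presentation) (O : CircuitObfuscator) (P : PuncturablePRFScheme),
    GenAdmissible D O P →
    ∃ n₀ : ℕ, ∀ s : List Bool, n₀ ≤ s.length →
      gen D.params O P s = (D.lineData Γ₁ P).gen O s ∧
        {y | ans D.params O P s <+: y} ⊆ {y | (D.lineData Γ₁ P).answer s <+: y}

/-- Statement of `stub_admissible`. -/
def AdmissibleLemma : Prop :=
  ∀ (D : MasterData) (Γ₁ : D.Presentation) (O : CircuitObfuscator) (P : PuncturablePRFScheme),
    GenAdmissible D O P → RefAdmissible D Γ₁ O → (D.lineData Γ₁ P).Admissible O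

/-- Statement of `stub_coherent`. -/
def CoherentLemma : Prop :=
  ∀ (D : MasterData) (Γ₁ : D.Presentation) (O : CircuitObfuscator) (P : PuncturablePRFScheme),
    GenAdmissible D O P → RefAdmissible D Γ₁ O → Coherent evalModel (D.lineData Γ₁ P).gen₀ (D.lineData Γ₁ P).answer

/-- **STUB 1 (S) — transport of clause (C)** along eventual agreement of the generators and containment of the
success events: for `n ≥ n₀` the level-`n` success average of any adversary against `(gen, ans)` is at most that
against `(gen', ans')` (same instances, smaller event: `RandAlg.pr` is monotone in the event, `uniformAvg` in the
integrand), and a nonnegative sequence eventually dominated by a superpolynomially decaying one decays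
superpolynomially (`SuperpolynomialDecay.trans_eventually_abs_le`). -/
theorem stub_transport :
    ∀ (gen gen' ans ans' : List Bool → List Bool),
      (∃ n₀ : ℕ, ∀ s : List Bool, n₀ ≤ s.length → gen s = gen' s ∧ {y | ans s <+: y} ⊆ {y | ans' s <+: y}) →
      ClauseC gen' ans' → ClauseC gen ans :=
  Summit.QuantumAdvantage.QuantumAdvantage.Theorems.WbwObfuscatedGluedTrees.KnowledgeOfWalk.Generator.stub_transport

/-- **STUB 2 (S/M) — factorisation of the landed generator through the line datum**, eventually in the seed length:
with `4 t n ≤ n` (`GenAdmissible` (4)) the line's key `s.take (4 t n)` is the generator's `keyMaterial s` and has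
level `|k| / 4 = t n`, so arity, presentation, security parameter and entrance name agree definitionally
(`MasterData.params_*`, `lineData_gen`); the coin segments agree once `c n = O.coins (ς (t n)) (Γ (t n) K)`
(`GenAdmissible` (8), `n ≥ n₀`); the answer event: `ans = name(EXIT)` zero-padded (`setOf_ans_prefix_subset`) and
`(D.lineData Γ₁ P).answer s = exitName` (`lineData_answer`, `params_exitName`). -/
theorem stub_factorisation :
    ∀ (D : MasterData) (Γ₁ : D.Presentation) (O : CircuitObfuscator) (P : PuncturablePRFScheme),
      GenAdmissible D O P →
      ∃ n₀ : ℕ, ∀ s : List Bool, n₀ ≤ s.length →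
        gen D.params O P s = (D.lineData Γ₁ P).gen O s ∧
          {y | ans D.params O P s <+: y} ⊆ {y | (D.lineData Γ₁ P).answer s <+: y} :=
  Summit.QuantumAdvantage.QuantumAdvantage.Theorems.WbwObfuscatedGluedTrees.KnowledgeOfWalk.Generator.stub_factorisation

/-- **STUB 3 (M) — admissibility of the line datum** (`LineData.Admissible`, seven clauses) from
`GenAdmissible ∧ RefAdmissible`: (1)–(4) are clauses (1)–(4) (`h n = 4 t n ≤ n`); (5) polynomial length of the two
clear instances and the keyed answer: `|boolPair c e| = 2|c| + 2 + |e|`, codes bounded by `q (ℓ + |k|) ≤ q (2n)`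
(ℕ-polynomials evaluate monotonically), names by `N ≤ 2N + size ≤ ς ℓ ≤ p n` (membership in `ppolyCircuits`);
(6) membership / equal size / equal function at level `ℓ = |k| / 4`; (7) the eventual coin discipline from the coin
clauses (key `k = s.take (4 t n)` has length `4 t n`, level `t n`). -/
theorem stub_admissible :
    ∀ (D : MasterData) (Γ₁ : D.Presentation) (O : CircuitObfuscator) (P : PuncturablePRFScheme),
      GenAdmissible D O P → RefAdmissible D Γ₁ O → (D.lineData Γ₁ P).Admissible O :=
  Summit.QuantumAdvantage.QuantumAdvantage.Theorems.WbwObfuscatedGluedTrees.KnowledgeOfWalk.Generator.stub_admissible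

/-- **STUB 4 (M, HARDEST; proved by the lead, `KowGenCoherent`) — coherence of the evaluating model with the clear
reference generator**: on every seed, `name(EXIT)` has length `N = |name(ENTRANCE)|`, is a VALID name of the instance
`⟨code (Γ₁ ℓ k), name(ENTRANCE)⟩` in `evalModel` (the code decodes; `Γ₁ ≡ Γ` computes `nbrBit`; the answer string on
`name(EXIT)` is `answerBits σ ν (ν EXIT)`, using `nameVal (nameOfVal N t) = t` for `t < ansLen N ≤ 2^N`; it decodes by
`decodeAnswer_answerBits` to the names of EXIT's two children, a nonempty list by `degree_eq`), and differs from
`name(ENTRANCE)`. -/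
theorem stub_coherent :
    ∀ (D : MasterData) (Γ₁ : D.Presentation) (O : CircuitObfuscator) (P : PuncturablePRFScheme),
      GenAdmissible D O P → RefAdmissible D Γ₁ O →
      Coherent evalModel (D.lineData Γ₁ P).gen₀ (D.lineData Γ₁ P).answer :=
  Summit.QuantumAdvantage.QuantumAdvantage.Theorems.WbwObfuscatedGluedTrees.KnowledgeOfWalk.Generator.stub_coherent

/-! ### Consistency: each named statement IS its registered stub (definitionally) -/

/-- `TransportLemma` holds (it IS the landed `stub_transport`). -/
theorem transportLemma_holds : TransportLemma := stub_transport
/-- `FactorisationLemma` holds (it IS the landed `stub_factorisation`). -/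
theorem factorisationLemma_holds : FactorisationLemma := stub_factorisation
/-- `AdmissibleLemma` holds (it IS the landed `stub_admissible`). -/
theorem admissibleLemma_holds : AdmissibleLemma := stub_admissible
/-- `CoherentLemma` holds (it IS the landed `stub_coherent`). -/
theorem coherentLemma_holds : CoherentLemma := stub_coherent

/-! ### Name-keyed aliases of the four statements (hypotheses of the composition) -/
namespace Registered

/-- Alias of `TransportLemma` keyed by the registered stub name. -/
abbrev stub_transport : Prop := TransportLemma
/-- Alias of `FactorisationLemma` keyed by the registered stub name. -/
abbrev stub_factorisation : Prop := FactorisationLemma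
/-- Alias of `AdmissibleLemma` keyed by the registered stub name. -/
abbrev stub_admissible : Prop := AdmissibleLemma
/-- Alias of `CoherentLemma` keyed by the registered stub name. -/
abbrev stub_coherent : Prop := CoherentLemma

end Registered

/-! ## §2 The target of stage 2 and its composition BY NAME -/

/-- **Stage-2 target.** Clause (C) of `WbwThesis` for the landed generator with master-parametrised schedules, for
every sub-exponentially secure iO and every PRF scheme, from the definitional admissibility of the data and the two
reference-presentation hypotheses KWA₀ (`KnowledgeOfWalk`) and WordHard₀ (`WordHard`) in the evaluating model. -/
def GeneratorTransfer : Prop :=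
  ∀ (D : MasterData) (Γ₁ : D.Presentation) (ε : ℝ) (O : CircuitObfuscator) (P : PuncturablePRFScheme),
    0 < ε → IsSubexpIO ε ppolyCircuits O → GenAdmissible D O P → RefAdmissible D Γ₁ O →
    KnowledgeOfWalk evalModel (D.lineData Γ₁ P).gen₀ →
    WordHard evalModel (D.lineData Γ₁ P).gen₀ (D.lineData Γ₁ P).answer →
    ClauseC (gen D.params O P) (ans D.params O P)

/-- **Composition: the four registered stubs and the closed stage-1 target give the stage-2 target BY NAME.**
`knowledgeTransfer_holds (D.lineData Γ₁ P)` (admissible by stub 3, coherent by stub 4) gives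
`ClauseC ((D.lineData Γ₁ P).gen O) (D.lineData Γ₁ P).answer`; stubs 2 and 1 move it onto `(gen D.params O P, ans D.params O P)`. -/
theorem WbwObfuscatedGluedTrees_of (h₁ : Registered.stub_transport) (h₂ : Registered.stub_factorisation)
    (h₃ : Registered.stub_admissible) (h₄ : Registered.stub_coherent) : GeneratorTransfer := by
  intro D Γ₁ ε O P hε hO hadm href hK hW
  have hC : ClauseC ((D.lineData Γ₁ P).gen O) (D.lineData Γ₁ P).answer :=
    knowledgeTransfer_holds (D.lineData Γ₁ P) ε O hε hO (h₃ D Γ₁ O P hadm href) (h₄ D Γ₁ O P hadm href) hK hW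
  exact h₁ _ _ _ _ (h₂ D Γ₁ O P hadm) hC

/-- **The stage-2 target holds** (all four registered stubs landed): `GeneratorTransfer`. -/
theorem generatorTransfer_holds : GeneratorTransfer :=
  WbwObfuscatedGluedTrees_of stub_transport stub_factorisation stub_admissible stub_coherent

/-! ## §3 Corollaries: the typed crux and the glue, modulo `ReferenceHardness` -/

/-- Clause (C) for the landed generator at an admissible master datum, from the stage-2 target and the residual
hypothesis `ReferenceHardness` (KWA₀ ∧ WordHard₀ for SOME admissible reference presentation). -/
theorem clauseC_of_referenceHardness (hGT : GeneratorTransfer) (D : MasterData) {ε : ℝ} (hε : 0 < ε)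
    {O : CircuitObfuscator} (hO : IsSubexpIO ε ppolyCircuits O) (P : PuncturablePRFScheme)
    (hadm : GenAdmissible D O P) (hRH : ReferenceHardness D O P) :
    ClauseC (gen D.params O P) (ans D.params O P) := by
  obtain ⟨Γ₁, href, hK, hW⟩ := hRH
  exact hGT D Γ₁ ε O P hε hO hadm href hK hW

/-- **The typed crux this stage supports** (shape `W` of `wbwEngine_of_obfuscatedGluedTreesGen_of_admissible`, with
`AdmC := GenAdmissible ∧ ReferenceHardness`): at every BPR15 §5.1 parameter point and every admissible master datum
carrying the reference hypothesis, clause (C) holds for `obfuscatedGluedTreesGen D.params`. -/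
def TypedCrux : Prop :=
  ∀ ε : ℝ, 0 < ε → ε < 1 → ∀ O : CircuitObfuscator, IsSubexpIO ε ppolyCircuits O →
    ∀ P : PuncturablePRFScheme, P.inLen = id → P.outLen = id →
      IsTDSecurePuncturablePRF P (fun κ => (2 : ℝ) ^ ((κ : ℝ) ^ ε)) (fun κ => (2 : ℝ) ^ (-((κ : ℝ) ^ ε))) →
    ∀ f : List Bool → List Bool, IsOneWay f → Function.Injective f → ∀ c : ℕ, 1 < (c : ℝ) * ε →
    ∀ D : MasterData, GenAdmissible D O P → ReferenceHardness D O P →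
      ClauseC (obfuscatedGluedTreesGen D.params O P f c).1 (obfuscatedGluedTreesGen D.params O P f c).2

/-- `GeneratorTransfer → TypedCrux` (the PRF security, `f` and `c` are not used by the transfer: they enter only
the truth of `ReferenceHardness`). -/
theorem typedCrux_of_generatorTransfer (hGT : GeneratorTransfer) : TypedCrux := by
  intro ε hε _ O hO P _ _ _ f _ _ c _ D hadm hRH
  rw [obfuscatedGluedTreesGen_fst, obfuscatedGluedTreesGen_snd]
  exact clauseC_of_referenceHardness hGT D hε hO P hadm hRH

/-- **`TypedCrux` holds** (stage 2 closed): the typed crux with the reference hypothesis as antecedent is PROVED —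
if the planner gives the informal item stmt-QuantumAdvantage-2340 this signature, it closes by this theorem. -/
theorem typedCrux_holds : TypedCrux := typedCrux_of_generatorTransfer generatorTransfer_holds

/-- **The route's engine modulo the residual hypothesis.** If at every BPR15 §5.1 parameter point some admissible
master datum carries `ReferenceHardness`, the generator's `FPData` and clause (Q), then `WbwEngine` — by the landed
glue `wbwEngine_of_obfuscatedGluedTreesGen` with `Λ := D.params`. -/
theorem wbwEngine_of_generatorTransfer (hGT : GeneratorTransfer)
    (h : ∀ ε : ℝ, 0 < ε → ε < 1 → ∀ O : CircuitObfuscator, IsSubexpIO ε ppolyCircuits O →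
      ∀ P : PuncturablePRFScheme, P.inLen = id → P.outLen = id →
        IsTDSecurePuncturablePRF P (fun κ => (2 : ℝ) ^ ((κ : ℝ) ^ ε))
          (fun κ => (2 : ℝ) ^ (-((κ : ℝ) ^ ε))) →
      ∀ f : List Bool → List Bool, IsOneWay f → Function.Injective f →
      ∃ D : MasterData, GenAdmissible D O P ∧ ReferenceHardness D O P ∧ FPData D.params O P ∧
        ∃ F : QCircuitFamily cliffordT, F.IsOracleFree ∧ F.IsUniform ∧
          ∀ s, 2 / 3 ≤ F.kernelProb 0 (gen D.params O P s) {y | ans D.params O P s <+: y}) :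
    Summit.QuantumAdvantage.QuantumAdvantage.Theses.WhiteBoxWalk.WbwEngine := by
  refine Summit.QuantumAdvantage.QuantumAdvantage.Theorems.WhiteBoxWalk.wbwEngine_of_obfuscatedGluedTreesGen ?_
  intro ε hε hε1 O hO P hPin hPout hP f hf hinj
  obtain ⟨D, hadm, hRH, hFP, hQ⟩ := h ε hε hε1 O hO P hPin hPout hP f hf hinj
  exact ⟨D.params, hFP, hQ, clauseC_of_referenceHardness hGT D hε hO P hadm hRH⟩

/-- **Admissibility at the level of parameter records** (shape `AdmC` of the landed three-item glue
`wbwEngine_of_obfuscatedGluedTreesGen_of_admissible`): `Λ` IS the record of some master datum admissible for `(O, P)`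
and carrying the reference hypothesis. -/
def MasterAdmissible (O : CircuitObfuscator) (P : PuncturablePRFScheme) (Λ : Params) : Prop :=
  ∃ D : MasterData, Λ = D.params ∧ GenAdmissible D O P ∧ ReferenceHardness D O P

/-- Clause (C) for `obfuscatedGluedTreesGen Λ` at every `MasterAdmissible` parameter record (the `W` of the
three-item glue with `AdmC := MasterAdmissible`), from the stage-2 target. -/
theorem clauseC_params_of_generatorTransfer (hGT : GeneratorTransfer) {ε : ℝ} (hε : 0 < ε)
    {O : CircuitObfuscator} (hO : IsSubexpIO ε ppolyCircuits O) (P : PuncturablePRFScheme) {Λ : Params}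
    (hΛ : MasterAdmissible O P Λ) : ClauseC (gen Λ O P) (ans Λ O P) := by
  obtain ⟨D, rfl, hadm, hRH⟩ := hΛ
  exact clauseC_of_referenceHardness hGT D hε hO P hadm hRH

/-- **The residual conjecture of the route after stage 2, as ONE closed statement** (the hypothesis of
`wbwEngine_of_generatorTransfer`, named): at every BPR15 §5.1 parameter point some admissible master datum carries the
reference hypothesis (KWA₀ ∧ WordHard₀ for one admissible reference presentation), the generator's polynomial-time data
and clause (Q).  Conjecture-grade (KWA₀) and crux-grade (WordHard₀); never asserted here. -/
def ResidualConjecture : Prop :=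
  ∀ ε : ℝ, 0 < ε → ε < 1 → ∀ O : CircuitObfuscator, IsSubexpIO ε ppolyCircuits O →
    ∀ P : PuncturablePRFScheme, P.inLen = id → P.outLen = id →
      IsTDSecurePuncturablePRF P (fun κ => (2 : ℝ) ^ ((κ : ℝ) ^ ε)) (fun κ => (2 : ℝ) ^ (-((κ : ℝ) ^ ε))) →
    ∀ f : List Bool → List Bool, IsOneWay f → Function.Injective f →
    ∃ D : MasterData, GenAdmissible D O P ∧ ReferenceHardness D O P ∧ FPData D.params O P ∧
      ∃ F : QCircuitFamily cliffordT, F.IsOracleFree ∧ F.IsUniform ∧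
        ∀ s, 2 / 3 ≤ F.kernelProb 0 (gen D.params O P s) {y | ans D.params O P s <+: y}

/-- `WbwEngine` from the (proved) stage-2 target and the residual conjecture. -/
theorem wbwEngine_of_residualConjecture (hGT : GeneratorTransfer) (hR : ResidualConjecture) :
    Summit.QuantumAdvantage.QuantumAdvantage.Theses.WhiteBoxWalk.WbwEngine :=
  wbwEngine_of_generatorTransfer hGT hR

/-- In particular, after stage 2 the route decl `WbwEngine` holds modulo `ResidualConjecture` alone. -/
theorem wbwEngine_of_residualConjecture' (hR : ResidualConjecture) :
    Summit.QuantumAdvantage.QuantumAdvantage.Theses.WhiteBoxWalk.WbwEngine :=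
  wbwEngine_of_residualConjecture generatorTransfer_holds hR

end Summit.QuantumAdvantage.QuantumAdvantage.Cruxes.WbwObfuscatedGluedTrees.KnowledgeOfWalkSplit.Generator
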